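import Literature.Topology.FourManifolds.RouteGraph
import HarnessLib

/-!
# The twisted height along a slice curve, II: the near-vertical criterion and Lipschitz bounds

Topic `Literature/Topology/FourManifolds`; fact seat `provefact-IsStrictHandleSlide.isSurgery`
(R. C. Kirby, *The Topology of 4-Manifolds*, LNM 1374 (1989), Ch. I §4; remaining content: the
named fact (S) `Literature.Topology.FourManifolds.FramedLink.IsStrictHandleSlide.slideModel`).
Continuation of `RouteGraph.lean` (twisted height `y = r sin α`, `α = twistAngle c r θ`, along a slice
curve `t ↦ (r t, θ t)`):

* `curveY_deriv_neg_of_nearVertical` — **the near-vertical criterion**: if `|cos α| ≤ s` (either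
  side of the vertical), `R c s ≤ 1/2`, `ṙ < 0` and the mixed term is small, `R q |θ̇| s < -ṙ sin α / 2`,
  then `ẏ < 0`. (Used from the tip to the start of the landing, where the radial speed is robust.)
* `twistAngle_curve_ge_lipschitz`, `twistAngle_curve_le_lipschitz` — **Lipschitz comparison**:
  from `|twistQ · θ̇| ≤ K` one gets `α t ≥ α t₁ + c (r t - r t₁) - K (t - t₁)` (for `ṙ ≤ 0`) and
  `α t ≤ α t₁ + K (t - t₁)`.

## References

* R. C. Kirby, *The Topology of 4-Manifolds*, LNM 1374, Springer (1989), Ch. I §4. [Kirby1989]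
-/

open scoped Topology
open Set Real Filter

noncomputable section

namespace Literature.Topology.FourManifolds

/-! ### The near-vertical criterion -/

section Sign

variable {c R r' θ' α q : ℝ}

/-- **Near the vertical** (`|cos α| ≤ s` with `R c s ≤ 1/2`), a robustly decreasing radius beats a
small mixed term: `ṙ < 0` and `R q |θ̇| s < -ṙ sin α / 2` give `ẏ < 0`. [folklore] -/
theorem curveY_deriv_neg_of_nearVertical (hc : 0 ≤ c) (hR : 0 < R) (hr : r' < 0) (hsin : 0 < sin α)
    (hq : 0 ≤ q) {s : ℝ} (hcos : |cos α| ≤ s) (hband : R * c * s ≤ 1 / 2)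
    (hmix : R * q * |θ'| * s < -r' * sin α / 2) :
    r' * sin α + R * (cos α * (c * sin α * r' + q * θ')) < 0 := by
  rw [curveY_deriv_eq]
  have hcl : -s ≤ cos α := (abs_le.1 hcos).1
  have hcu : cos α ≤ s := (abs_le.1 hcos).2
  -- the radial term: `ṙ sin α (1 + R c cos α) ≤ ṙ sin α (1 - R c s) ≤ ṙ sin α / 2`
  have hk : r' * sin α < 0 := mul_neg_of_neg_of_pos hr hsin
  have h1 : 1 - R * c * s ≤ 1 + R * c * cos α := by nlinarith [mul_nonneg hR.le hc]
  have h2 : r' * sin α * (1 + R * c * cos α) ≤ r' * sin α * (1 - R * c * s) :=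
    mul_le_mul_of_nonpos_left h1 hk.le
  have h3 : r' * sin α * (1 - R * c * s) ≤ r' * sin α * (1 / 2) :=
    mul_le_mul_of_nonpos_left (by linarith) hk.le
  -- the mixed term: `R cos α q θ̇ ≤ R q |θ̇| s`
  have h4 : R * cos α * q * θ' ≤ R * q * |θ'| * s := by
    have e : R * cos α * q * θ' = (R * q) * (cos α * θ') := by ring
    have e' : R * q * |θ'| * s = (R * q) * (|θ'| * s) := by ring
    rw [e, e']
    refine mul_le_mul_of_nonneg_left ?_ (by positivity)
    calc cos α * θ' ≤ |cos α * θ'| := le_abs_self _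
      _ = |cos α| * |θ'| := abs_mul _ _
      _ ≤ s * |θ'| := mul_le_mul_of_nonneg_right hcos (abs_nonneg _)
      _ = |θ'| * s := mul_comm _ _
  nlinarith

end Sign

/-! ### Lipschitz comparison for the twist angle along a curve -/

section Bounds

variable {c : ℝ} {r θ dr dθ : ℝ → ℝ} {t₁ t₂ : ℝ}

/-- **Lower Lipschitz comparison.** On `[t₁, t₂]` let `ṙ ≤ 0`, `θ ∈ (-π, π)`, `c ≥ 0` and
`twistQ · θ̇ ≥ -K`. Then `α t ≥ α t₁ + c (r t - r t₁) - K (t - t₁)`. [folklore] -/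
theorem twistAngle_curve_ge_lipschitz (hc : 0 ≤ c) (ht : t₁ ≤ t₂)
    (hr : ∀ t ∈ Icc t₁ t₂, HasDerivAt r (dr t) t) (hθ : ∀ t ∈ Icc t₁ t₂, HasDerivAt θ (dθ t) t)
    (hθm : ∀ t ∈ Icc t₁ t₂, θ t ∈ Ioo (-π) π) (hdr : ∀ t ∈ Icc t₁ t₂, dr t ≤ 0)
    {K : ℝ} (hK : ∀ t ∈ Icc t₁ t₂, -K ≤ twistQ c (r t) (θ t) * dθ t)
    {t : ℝ} (htt : t ∈ Icc t₁ t₂) :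
    twistAngle c (r t₁) (θ t₁) + c * (r t - r t₁) - K * (t - t₁) ≤ twistAngle c (r t) (θ t) := by
  set ψ : ℝ → ℝ := fun s ↦ twistAngle c (r s) (θ s) - c * r s + K * s with hψ
  have hψd : ∀ s ∈ Icc t₁ t₂, HasDerivAt ψ
      ((c * sin (twistAngle c (r s) (θ s)) * dr s + twistQ c (r s) (θ s) * dθ s) - c * dr s + K * 1) s :=
    fun s hs ↦ ((hasDerivAt_twistAngle_curve c (hr s hs) (hθ s hs) (hθm s hs)).sub ((hr s hs).const_mul c)).add
      ((hasDerivAt_id s).const_mul K)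
  have hmono : MonotoneOn ψ (Icc t₁ t₂) := by
    refine monotoneOn_of_deriv_nonneg (convex_Icc _ _) ?_ ?_ ?_
    · exact fun s hs ↦ (hψd s hs).continuousAt.continuousWithinAt
    · intro s hs
      rw [interior_Icc] at hs
      exact (hψd s (Ioo_subset_Icc_self hs)).differentiableAt.differentiableWithinAt
    · intro s hs
      rw [interior_Icc] at hs
      have hs' := Ioo_subset_Icc_self hs
      rw [(hψd s hs').deriv]
      have h1 : sin (twistAngle c (r s) (θ s)) ≤ 1 := sin_le_one _
      have h2 := hdr s hs'; have h4 := hK s hs'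
      nlinarith [mul_nonneg hc (mul_nonneg (sub_nonneg.2 h1) (neg_nonneg.2 h2))]
  have := hmono ⟨le_rfl, ht⟩ htt htt.1
  simp only [hψ] at this
  linarith

/-- **Upper Lipschitz comparison.** On `[t₁, t₂]` let `ṙ ≤ 0`, `θ ∈ [0, π)`, `c ≥ 0` and
`twistQ · θ̇ ≤ K`. Then `α t ≤ α t₁ + K (t - t₁)`. [folklore] -/
theorem twistAngle_curve_le_lipschitz (hc : 0 ≤ c) (ht : t₁ ≤ t₂)
    (hr : ∀ t ∈ Icc t₁ t₂, HasDerivAt r (dr t) t) (hθ : ∀ t ∈ Icc t₁ t₂, HasDerivAt θ (dθ t) t)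
    (hθm : ∀ t ∈ Icc t₁ t₂, θ t ∈ Ico 0 π) (hdr : ∀ t ∈ Icc t₁ t₂, dr t ≤ 0)
    {K : ℝ} (hK : ∀ t ∈ Icc t₁ t₂, twistQ c (r t) (θ t) * dθ t ≤ K)
    {t : ℝ} (htt : t ∈ Icc t₁ t₂) :
    twistAngle c (r t) (θ t) ≤ twistAngle c (r t₁) (θ t₁) + K * (t - t₁) := by
  have hθm' : ∀ t ∈ Icc t₁ t₂, θ t ∈ Ioo (-π) π := fun s hs ↦ ⟨by linarith [(hθm s hs).1, pi_pos], (hθm s hs).2⟩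
  set ψ : ℝ → ℝ := fun s ↦ twistAngle c (r s) (θ s) - K * s with hψ
  have hψd : ∀ s ∈ Icc t₁ t₂, HasDerivAt ψ
      ((c * sin (twistAngle c (r s) (θ s)) * dr s + twistQ c (r s) (θ s) * dθ s) - K * 1) s :=
    fun s hs ↦ (hasDerivAt_twistAngle_curve c (hr s hs) (hθ s hs) (hθm' s hs)).sub ((hasDerivAt_id s).const_mul K)
  have hanti : AntitoneOn ψ (Icc t₁ t₂) := by
    refine antitoneOn_of_deriv_nonpos (convex_Icc _ _) ?_ ?_ ?_
    · exact fun s hs ↦ (hψd s hs).continuousAt.continuousWithinAt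
    · intro s hs
      rw [interior_Icc] at hs
      exact (hψd s (Ioo_subset_Icc_self hs)).differentiableAt.differentiableWithinAt
    · intro s hs
      rw [interior_Icc] at hs
      have hs' := Ioo_subset_Icc_self hs
      rw [(hψd s hs').deriv]
      have h1 : 0 ≤ sin (twistAngle c (r s) (θ s)) := by
        have hα := twistAngle_mem_Ioo c (r s) (θ s)
        rcases (hθm s hs').1.eq_or_lt with h0 | h0
        · rw [← h0, twistAngle_zero, sin_zero]
        · exact sin_nonneg_of_nonneg_of_le_pi (twistAngle_pos c (r s) ⟨h0, (hθm s hs').2⟩).le hα.2.le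
      have h2 := hdr s hs'; have h4 := hK s hs'
      nlinarith [mul_nonneg (mul_nonneg hc h1) (neg_nonneg.2 h2)]
  have := hanti ⟨le_rfl, ht⟩ htt htt.1
  simp only [hψ] at this
  linarith

end Bounds

end Literature.Topology.FourManifolds
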